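import Summits.QuantumFields.BalabanUV.Beta.GAN24.SrecAtRowHoldsFinal
import Summits.QuantumFields.BalabanUV.Beta.GAN24.WilsonSectorRateHolds
import Summits.QuantumFields.BalabanUV.Beta.GAN24.SrecAtRateOfSectors

/-!
# `BalabanUV.Beta.GAN24.SrecAtSlotRows` — binder row G-an2-4 / (CONV-C), CT-ROUTE: **THE S-SLOT ROWS `(hS, hSall)` OF THE RECURSIVE COMB FAMILY (E) = `SrecAt`
# IN THE CONSUMER's EXACT BINDER SHAPE, FROM THE BORN SECTORS' RATE LETTER ALONE** — hS0 (the owner's `SrecAtRowHoldsFinal.exists_hS0_SrecAt_three`, UNCONDITIONAL)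
# and hSdev of the Wilson sector (`WilsonSectorRateHolds.exists_hSdev_wilsonSec_three`, UNCONDITIONAL) joined with the born remainder's all-scales letter hBdev
# (HYPOTHESIS `hB`: the crux team's sockets — leaf-04 g57's `BornBorderDrift.exists_hBdev_of_sectors` over leaf-04's V END and leaf-06 g41's
# `BornLambdaDriftSup.exists_hBdevLam_three_of_supPairs`, themselves waiting on the sup-norm pair letters) through the S-row junction
# `SrecAtRateOfSectors.exists_hSall_SrecAt_of_sectors`, at ONE common locality rate `δS`.

NOT IN PRINT; OUR BOOKKEEPING (row owner `b2b-balaban-gan24-p1`, gen 22; [folklore] assembly BY NAME + `min` of two rates).  HONEST FRAMING (cell contract,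
verbatim): «discharging `BetaPertH` makes Bałaban's UV stability UNCONDITIONAL — a real constructive-QFT result; it is NOT the continuum limit and NOT the Clay
problem.»  HONEST DEPENDENCY (verbatim): «continuum YM on T⁴ ⇐ BetaPertH ∧ nine spine estimates (0/9 proved); BetaPertH ⇐ (D1) ∧ (D4) ∧ CAP+tail; G-an2-4 gates asym,
D1 and NE2/3/4.»  No cited fact, no wall binder, no `def`, no `def … : Prop`, 0 sorry.  WHAT THIS IS AND IS NOT: CONDITIONAL on `hB` (the born sectors' rate
half, OPEN); when it lands the pair `(hS, hSall)` below is, for `rr := ctrOff (3+1) Lc`, `cE := Lc^4`, `cVH := −Lc^8∕2`, `cΛ := 2∕Lc^4`, LITERALLY the S-slot residual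
of road FP's literal of record (`FP.RoadRowD1Slots.d1Drift_JsRowD1_of_slots_wardLetters_explicitDefect`, `D1BFx.RoadEndRowPinned.exists_allScalesSeq_JsRowD1Pin_of_slots`:
binders `hS hSall hδS hθS0 hθS1`) — the COMB family at the centre root, so CT-5 (the sym family `JsB12Sym`) is NOT on that literal's path; the W-slot rows
(`hW`, `hWall` on `unitW … (WrecAt …)`) are NOT touched; NEVER «G-an2-4 closed» as (CONV-C); NOT D1, NOT `BetaPertH`, NOT continuum, NOT Clay.
Unit `b2b-balaban-gan24-p1` (row owner G-an2-4, gen 22), 2026-08-21.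
-/

noncomputable section

open Literature.MathematicalPhysics.QuantumFieldTheory.Balaban1983to89.Beta
open OneStepResolventKernel (LocStencil)
open AffineAveraging (box toSite)
open AveragingContoursRooted (ctrOff ctrOff_mem_box)
open Summit.QuantumFields.BalabanUV.Beta.HessKerDressedUnits (unitS)
open Summit.QuantumFields.BalabanUV.Beta.GAN24.CombesThomas (sfStep smStep)
open Summit.QuantumFields.BalabanUV.Beta.WardLocusRecursive (SrecAt)
open Summit.QuantumFields.BalabanUV.Beta.GAN24.SrecWilsonSector (bornSecAt)
open Summit.QuantumFields.BalabanUV.Beta.GAN24.StencilSlotOfShapes (locStencil_mono')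
open Summit.QuantumFields.BalabanUV.Beta.GAN24.SrecAtRowHoldsFinal (exists_hS0_SrecAt_three)
open Summit.QuantumFields.BalabanUV.Beta.GAN24.WilsonSectorRateHolds (exists_hSdev_wilsonSec_three)
open Summit.QuantumFields.BalabanUV.Beta.GAN24.SrecAtRateOfSectors (exists_hSall_SrecAt_of_sectors)

namespace Summit.QuantumFields.BalabanUV.Beta.GAN24.SrecAtSlotRows

variable {Lc : ℕ} [NeZero Lc]

/-- NOT IN PRINT; OUR PROOF ATTEMPT ([folklore] assembly).  **(hSall) OF THE `d = 3` COMB FAMILY FROM THE BORN SECTORS' RATE LETTER** (`Lc ≥ 2`, pin `cE = Lc^4`,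
every `cVH cΛ`): the S-row junction with the Wilson sector's hSdev (UNCONDITIONAL) plugged in — `hB` is the only hypothesis left. -/
theorem exists_hSall_SrecAt_three_of_born (hLc : 2 ≤ Lc) {cE : ℝ} (hcE : cE = (Lc : ℝ) ^ (3 + 1)) (cVH cΛ : ℝ)
    (hB : ∃ cB θB δB : ℝ, 0 ≤ cB ∧ 0 ≤ θB ∧ θB < 1 ∧ 0 < δB ∧ ∀ (rr : Fin (3 + 1) → ℕ), rr ∈ box (3 + 1) Lc → ∀ k j : ℕ,
      LocStencil (unitS (sfStep Lc (k + j)) (smStep 3 Lc (k + j)) (bornSecAt Lc (toSite rr) cE cVH cΛ (k + j))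
        - unitS (sfStep Lc k) (smStep 3 Lc k) (bornSecAt Lc (toSite rr) cE cVH cΛ k)) (cB * θB ^ k) δB) :
    ∃ cS θS δS : ℝ, 0 ≤ cS ∧ 0 ≤ θS ∧ θS < 1 ∧ 0 < δS ∧ ∀ (rr : Fin (3 + 1) → ℕ), rr ∈ box (3 + 1) Lc → ∀ k j : ℕ,
      LocStencil (unitS (sfStep Lc (k + j)) (smStep 3 Lc (k + j)) (SrecAt 3 Lc (toSite rr) cE cVH cΛ (k + j))
        - unitS (sfStep Lc k) (smStep 3 Lc k) (SrecAt 3 Lc (toSite rr) cE cVH cΛ k)) (cS * θS ^ k) δS :=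
  exists_hSall_SrecAt_of_sectors (d := 3) cE cVH cΛ (exists_hSdev_wilsonSec_three hLc hcE) hB

/-- NOT IN PRINT; OUR PROOF ATTEMPT ([folklore] assembly).  **THE S-SLOT ROWS `(hS, hSall)` OF THE `d = 3` COMB FAMILY AT ONE COMMON RATE, FROM THE BORN SECTORS'
RATE LETTER** (`Lc ≥ 2`, pin `cE = Lc^4`, every `cVH cΛ`): `∃ Cs cS θS δS, 0 ≤ θS ∧ θS < 1 ∧ 0 < δS ∧` (for every in-block root `rr`)
`(∀ j, LocStencil (unitS_j (SrecAt … j)) Cs δS) ∧ (∀ k j, LocStencil (unitS_{k+j}(SrecAt … (k+j)) − unitS_k(SrecAt … k)) (cS·θS^k) δS)` — hS0 (`SrecAtRowHoldsFinal`) and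
(hSall) (`exists_hSall_SrecAt_three_of_born`) at `δS := min`.  At `rr := ctrOff 4 Lc`, `cE := Lc^4`, `cVH := −Lc^8∕2`, `cΛ := 2∕Lc^4` these are the binders
`hS hSall hδS hθS0 hθS1` of `D1BFx.RoadEndRowPinned.exists_allScalesSeq_JsRowD1Pin_of_slots`. -/
theorem exists_hS_hSall_SrecAt_three_of_born (hLc : 2 ≤ Lc) {cE : ℝ} (hcE : cE = (Lc : ℝ) ^ (3 + 1)) (cVH cΛ : ℝ)
    (hB : ∃ cB θB δB : ℝ, 0 ≤ cB ∧ 0 ≤ θB ∧ θB < 1 ∧ 0 < δB ∧ ∀ (rr : Fin (3 + 1) → ℕ), rr ∈ box (3 + 1) Lc → ∀ k j : ℕ,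
      LocStencil (unitS (sfStep Lc (k + j)) (smStep 3 Lc (k + j)) (bornSecAt Lc (toSite rr) cE cVH cΛ (k + j))
        - unitS (sfStep Lc k) (smStep 3 Lc k) (bornSecAt Lc (toSite rr) cE cVH cΛ k)) (cB * θB ^ k) δB) :
    ∃ Cs cS θS δS : ℝ, 0 ≤ θS ∧ θS < 1 ∧ 0 < δS ∧ ∀ (rr : Fin (3 + 1) → ℕ), rr ∈ box (3 + 1) Lc →
      (∀ j : ℕ, LocStencil (unitS (sfStep Lc j) (smStep 3 Lc j) (SrecAt 3 Lc (toSite rr) cE cVH cΛ j)) Cs δS) ∧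
      (∀ k j : ℕ, LocStencil (unitS (sfStep Lc (k + j)) (smStep 3 Lc (k + j)) (SrecAt 3 Lc (toSite rr) cE cVH cΛ (k + j))
        - unitS (sfStep Lc k) (smStep 3 Lc k) (SrecAt 3 Lc (toSite rr) cE cVH cΛ k)) (cS * θS ^ k) δS) := by
  obtain ⟨Cs, δ₀, hδ₀, hS⟩ := exists_hS0_SrecAt_three (Lc := Lc) hLc hcE cVH cΛ
  obtain ⟨cS, θS, δ₁, -, hθS0, hθS1, hδ₁, hSall⟩ := exists_hSall_SrecAt_three_of_born (Lc := Lc) hLc hcE cVH cΛ hB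
  refine ⟨Cs, cS, θS, min δ₀ δ₁, hθS0, hθS1, lt_min hδ₀ hδ₁, fun rr hrr => ⟨fun j => ?_, fun k j => ?_⟩⟩
  · exact locStencil_mono' (hS rr hrr j) le_rfl (min_le_left _ _)
  · exact locStencil_mono' (hSall rr hrr k j) le_rfl (min_le_right _ _)

/-- NOT IN PRINT; OUR PROOF ATTEMPT ([folklore] assembly).  **THE SAME AT THE CENTRE ROOT AND THE D1 PINS** (`Lc ≥ 2`, `ρ_c = toSite (ctrOff (3+1) Lc)`,
`cE := Lc^4`, `cVH := −Lc^8∕2`, any `cΛ`) — the `hS ∕ hSall ∕ hδS ∕ hθS0 ∕ hθS1` binders of road FP's literal of record (`D1BFx.RoadEndRowPinned.exists_allScalesSeq_JsRowD1Pin_of_slots`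
at `cΛ := 2∕Lc^4`; `FP.RoadRowD1Slots` at any `cΛ`) for the COMB family, from the born sectors' rate letter `hB` ALONE. -/
theorem exists_hS_hSall_SrecAt_ctr_of_born (hLc : 2 ≤ Lc) (cΛ : ℝ)
    (hB : ∃ cB θB δB : ℝ, 0 ≤ cB ∧ 0 ≤ θB ∧ θB < 1 ∧ 0 < δB ∧ ∀ (rr : Fin (3 + 1) → ℕ), rr ∈ box (3 + 1) Lc → ∀ k j : ℕ,
      LocStencil (unitS (sfStep Lc (k + j)) (smStep 3 Lc (k + j)) (bornSecAt Lc (toSite rr) ((Lc : ℝ) ^ 4) (-((Lc : ℝ) ^ 8 / 2)) cΛ (k + j))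
        - unitS (sfStep Lc k) (smStep 3 Lc k) (bornSecAt Lc (toSite rr) ((Lc : ℝ) ^ 4) (-((Lc : ℝ) ^ 8 / 2)) cΛ k)) (cB * θB ^ k) δB) :
    ∃ Cs cS θS δS : ℝ, 0 ≤ θS ∧ θS < 1 ∧ 0 < δS ∧
      (∀ j : ℕ, LocStencil (unitS (sfStep Lc j) (smStep 3 Lc j)
        (SrecAt 3 Lc (toSite (ctrOff (3 + 1) Lc)) ((Lc : ℝ) ^ 4) (-((Lc : ℝ) ^ 8 / 2)) cΛ j)) Cs δS) ∧
      (∀ k j : ℕ, LocStencil (unitS (sfStep Lc (k + j)) (smStep 3 Lc (k + j))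
          (SrecAt 3 Lc (toSite (ctrOff (3 + 1) Lc)) ((Lc : ℝ) ^ 4) (-((Lc : ℝ) ^ 8 / 2)) cΛ (k + j))
        - unitS (sfStep Lc k) (smStep 3 Lc k)
          (SrecAt 3 Lc (toSite (ctrOff (3 + 1) Lc)) ((Lc : ℝ) ^ 4) (-((Lc : ℝ) ^ 8 / 2)) cΛ k)) (cS * θS ^ k) δS) := by
  obtain ⟨Cs, cS, θS, δS, hθS0, hθS1, hδS, h⟩ :=
    exists_hS_hSall_SrecAt_three_of_born (Lc := Lc) hLc (cE := (Lc : ℝ) ^ 4) rfl (-((Lc : ℝ) ^ 8 / 2)) cΛ hB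
  exact ⟨Cs, cS, θS, δS, hθS0, hθS1, hδS, h (ctrOff (3 + 1) Lc) (ctrOff_mem_box (by omega))⟩

end Summit.QuantumFields.BalabanUV.Beta.GAN24.SrecAtSlotRows

end
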